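import Summits.ValiantsHypothesis.ValiantsHypothesis.Theorems.NcShapeRings
import HarnessLib

/-!
# Anti-concentration: masks designating no node of a shape are few — F3 of O-L6-21

THE THEOREM (★★ `card_undesignated_le`; FLOS20 Lemma 21 / LLS18 Claim 15 in COUNTING form, own
proof). For a shape `S` of size `d` and `g ≥ 1`, call an internal node `[a, a+m)` of `S`
`g`-IMBALANCED under the mask `Y : Fin d → Bool` if `|h(a+m) − h(a)| ≥ g` (`ivBig`;
`h = hgt Y` the ±1 height). The masks under which NO internal node of `S` is `g`-imbalanced
(`des (ivBig Y g) S 0 = none`) number at most `(13/16)^{⌊d/64g²⌋} · 2^d`.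
PROOF. The ring certificate of F2 at blob scale `16g² = 4(2g)²` is a list of `r` pairwise-disjoint
position sets of mass `≥ 16g²` each, `4·16g²·r ≥ d + 16g²` (so `r ≥ ⌊d/64g²⌋`), and the sign
sum of `Y` over a ring is `Δ(outer node) − Δ(inner node)` (`bsum_ringSet`), hence `< 2g` in
absolute value when no node is imbalanced (VALIDITY `ring_small_of_des_none`); F1's product
small-ball count `small_ball_prod` bounds the masks passing all `r` tests by `(13/16)^r · 2^d`.
COROLLARY (★ `exists_balanced_designating`, the union bound with `4^n ≤ (2n+1)·binom(2n,n)` BY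
NAME): fewer than `16^q / ((2n+1)·13^q)` shapes of size `2n`, `q = ⌊2n/64g²⌋`, are
SIMULTANEOUSLY designated at imbalance `g` by one balanced mask; and imbalance `≥ g` under a
balanced mask is `(n − g)`-good for the Hankel-interval instrument (`des_ivGood_ne_none`,
`ivGood_of_le` BY NAME).
ROLE IN THE SERIES (O-L6-21, decomp-valiant lens 6): F1 `NcSignSmallBall` → F2 `NcShapeRings` →
F3 (this) → F4 `NcFewShapesPermanent` (the few-shapes rung for `PERM_{2n}`). BY NAME: `des`
(NcHankelIntervalModel), `ivGood` (NcHankelIntervalBound), `hgt`, `ivGood_of_le`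
(NcNonSkewDepthShapes), `bsum`, `small_ball_prod` (F1), `inodes`, `rings`, `ringSet`,
`rings_wf_root`, `rings_pairwise_disjoint`, `card_ringSet_ge`, `length_rings` (F2).
HONEST LINE: a counting lemma about ONE shape and a union bound over a LIST of shapes; instrument
only; 0 S-currency; closes NO item; A_nc stmt-23446 / PerNotNcVP / VP ≠ VNP untouched.
HONEST BOUNDARY pointer (verbatim sentence + critic LABEL in F4 `NcFewShapesPermanent`): the series
proves a RUNG on the commutativity dial in a RESTRICTED MODEL (few full-degree parse-tree SHAPES),
print-KNOWN (FLOS20 Thm 23 / LLS18 Thm 13), S-implied · WEAKER than A_nc =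
`CommutativityDial.PerNotNcVP` (stmt-23446, OPEN · UNDECIDED · IDEA-NEEDED); VP ≠ VNP untouched.
[cite: FijalkowLagardeOhlmannSerre2020, Lemma 21, Theorem 23]
[cite: LagardeLimayeSrinivasan2018, Claim 15, Subclaim 16, Theorem 13]
-/

noncomputable section

open Finset

namespace Summit.ValiantsHypothesis.ValiantsHypothesis.Theorems.NcShapeAnticoncentration

set_option linter.dupNamespace false
open Summit.ValiantsHypothesis.ValiantsHypothesis.Theorems.NcUniqueParseTree
  Summit.ValiantsHypothesis.ValiantsHypothesis.Theorems.NcParseTrees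
  Summit.ValiantsHypothesis.ValiantsHypothesis.Theorems.NcHankelIntervalModel
  Summit.ValiantsHypothesis.ValiantsHypothesis.Theorems.NcHankelIntervalBound
  Summit.ValiantsHypothesis.ValiantsHypothesis.Theorems.NcNonSkewDepthShapes
  Summit.ValiantsHypothesis.ValiantsHypothesis.Theorems.NcSignSmallBall
  Summit.ValiantsHypothesis.ValiantsHypothesis.Theorems.NcShapeRings

/-! ### §1 Designation and imbalance -/

/-- `des` finds nothing iff every internal node is bad.
[cite: FijalkowLagardeOhlmannSerre2020, Theorem 5] -/
theorem des_eq_none_iff (good : ℕ → ℕ → Bool) (S : Shape) (α : ℕ) :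
    des good S α = none ↔ ∀ I ∈ inodes S α, good I.1 I.2 = false := by
  induction S generalizing α with
  | leaf => simp [des, inodes]
  | node l r ihl ihr =>
    rw [inodes, List.forall_mem_cons, List.forall_mem_append, ← ihl, ← ihr]
    simp only [des]
    split_ifs with h <;> simp [h]

/-- monotonicity: a weaker goodness predicate designates whenever a stronger one does.
[cite: FijalkowLagardeOhlmannSerre2020, Theorem 5] -/
theorem des_ne_none_mono {good good' : ℕ → ℕ → Bool}
    (h : ∀ a m, good a m = true → good' a m = true) (S : Shape) (α : ℕ)
    (hS : des good S α ≠ none) : des good' S α ≠ none := by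
  intro h'
  rw [des_eq_none_iff] at h'
  apply hS
  rw [des_eq_none_iff]
  intro I hI
  cases hb : good I.1 I.2 with
  | false => rfl
  | true => exact absurd (h' I hI) (by rw [h _ _ hb]; decide)

/-- `g`-IMBALANCED intervals of the mask `Y`: `|h(a+m) − h(a)| ≥ g`.
[cite: FijalkowLagardeOhlmannSerre2020, Lemma 21] -/
def ivBig {d : ℕ} (Y : Fin d → Bool) (g : ℕ) : ℕ → ℕ → Bool :=
  fun a m => decide ((g : ℤ) ≤ |hgt Y (a + m) - hgt Y a|)

/-- bridge to the instrument's goodness: for `|Y|, |Yᶜ| ≤ δ + g`, imbalance `≥ g` is `δ`-good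
(`ivGood_of_le` BY NAME). [cite: FijalkowLagardeOhlmannSerre2020, Theorem 5, Lemma 21] -/
theorem des_ivGood_ne_none {d : ℕ} (Y : Fin d → Bool) {δ g : ℕ}
    (hP : Fintype.card {i : Fin d // Y i = true} ≤ δ + g)
    (hQ : Fintype.card {i : Fin d // Y i = false} ≤ δ + g) (S : Shape)
    (hS : des (ivBig Y g) S 0 ≠ none) : des (ivGood Y δ) S 0 ≠ none :=
  des_ne_none_mono (fun _ _ h => ivGood_of_le Y hP hQ (by simpa [ivBig] using h)) S 0 hS

/-! ### §2 Ring sums and validity -/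

/-- the sign sum over an interval is a height difference.
[cite: FijalkowLagardeOhlmannSerre2020, §3.2] -/
theorem bsum_iv {d : ℕ} (Y : Fin d → Bool) (a m : ℕ) :
    bsum Y (univ.filter (fun j : Fin d => a ≤ j.val ∧ j.val < a + m)) =
      hgt Y (a + m) - hgt Y a := by
  unfold bsum hgt
  rw [Finset.sum_filter, ← Finset.sum_sub_distrib]
  refine Finset.sum_congr rfl fun j _ => ?_
  by_cases h1 : j.val < a
  · rw [if_neg (show ¬(a ≤ j.val ∧ j.val < a + m) by omega),
      if_pos (show j.val < a + m by omega), if_pos h1, sub_self]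
  · by_cases h2 : j.val < a + m
    · rw [if_pos (show a ≤ j.val ∧ j.val < a + m by omega), if_pos h2, if_neg h1, sub_zero]
    · rw [if_neg (show ¬(a ≤ j.val ∧ j.val < a + m) by omega), if_neg h2, if_neg h1, sub_zero]

/-- the sign sum over a ring with nested (or no) inner interval: `Δ(outer) − Δ(inner)`.
[cite: FijalkowLagardeOhlmannSerre2020, Lemma 21] -/
theorem bsum_ringSet {d : ℕ} (Y : Fin d → Bool) (R : (ℕ × ℕ) × (ℕ × ℕ))
    (h : R.2.2 = 0 ∨ (R.1.1 ≤ R.2.1 ∧ R.2.1 + R.2.2 ≤ R.1.1 + R.1.2)) :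
    bsum Y (ringSet d R) = (hgt Y (R.1.1 + R.1.2) - hgt Y R.1.1) -
      (hgt Y (R.2.1 + R.2.2) - hgt Y R.2.1) := by
  obtain ⟨hsub, hset⟩ := inner_subset_outer (d := d) R h
  rw [← bsum_iv, ← bsum_iv, hset]
  exact Finset.sum_sdiff_eq_sub hsub

/-- VALIDITY: if NO internal node of `S` is `g`-imbalanced, every ring sum is `< 2g` in absolute
value. [cite: FijalkowLagardeOhlmannSerre2020, Lemma 21] -/
theorem ring_small_of_des_none {g B d : ℕ} (S : Shape) (hS : S.size = d) (Y : Fin d → Bool)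
    (hY : des (ivBig Y g) S 0 = none) :
    ∀ R ∈ rings B S 0 none, |bsum Y (ringSet d R)| < ((2 * g : ℕ) : ℤ) := by
  subst hS
  intro R hR
  have hB := two_le_of_mem_rings B S 0 none R hR
  rw [des_eq_none_iff] at hY
  have small : ∀ I ∈ inodes S 0, |hgt Y (I.1 + I.2) - hgt Y I.1| < g := fun I hI => by
    have h := hY I hI
    simpa [ivBig] using h
  obtain ⟨w1, w2, -⟩ := rings_wf_root B hB S 0 R hR
  have h1 := small R.1 w1
  have hg : (0 : ℤ) ≤ g := Nat.cast_nonneg _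
  rw [bsum_ringSet Y R (w2.imp_right fun h => h.2)]
  rcases w2 with h0 | ⟨h2, -⟩
  · rw [h0, add_zero, sub_self, sub_zero]
    push_cast
    linarith
  · have h3 := small R.2 h2
    calc |_ - _|
        ≤ |hgt Y (R.1.1 + R.1.2) - hgt Y R.1.1| + |hgt Y (R.2.1 + R.2.2) - hgt Y R.2.1| :=
          abs_sub _ _
      _ < g + g := add_lt_add h1 h3
      _ = ((2 * g : ℕ) : ℤ) := by push_cast; ring

/-! ### §3 The count -/

/-- ★★ ANTI-CONCENTRATION COUNT (FLOS20 Lemma 21 / LLS18 Claim 15 in counting form, own route):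
the masks leaving a shape of size `d` with NO `g`-imbalanced internal node are at most
`(13/16)^{⌊d/64g²⌋} · 2^d`. [cite: FijalkowLagardeOhlmannSerre2020, Lemma 21]
[cite: LagardeLimayeSrinivasan2018, Claim 15] -/
theorem card_undesignated_le (g : ℕ) (hg : 1 ≤ g) (S : Shape) {d : ℕ} (hS : S.size = d) :
    16 ^ (d / (64 * g ^ 2)) *
        (univ.filter (fun Y : Fin d → Bool => des (ivBig Y g) S 0 = none)).card ≤
      13 ^ (d / (64 * g ^ 2)) * 2 ^ d := by
  have hB : 2 ≤ 16 * g ^ 2 := by have := Nat.one_le_pow 2 g hg; omega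
  -- the tests: one per ring of the certificate at blob scale `16g² = 4(2g)²`
  set tests := (rings (16 * g ^ 2) S 0 none).map (fun R => (ringSet d R, 2 * g)) with htests
  have hdisj : tests.Pairwise (fun s t => Disjoint s.1 t.1) := by
    rw [htests, List.pairwise_map]
    exact rings_pairwise_disjoint _ hB S hS
  have hbig : ∀ t ∈ tests, 4 * t.2 ^ 2 ≤ t.1.card := by
    intro t ht
    rw [htests, List.mem_map] at ht
    obtain ⟨R, hR, rfl⟩ := ht
    have h1 := card_ringSet_ge _ hB S hS R hR
    have h2 : 4 * (2 * g) ^ 2 = 16 * g ^ 2 := by ring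
    show 4 * (2 * g) ^ 2 ≤ (ringSet d R).card
    omega
  have hprod := small_ball_prod tests hdisj hbig
  -- masks designating nothing pass every test
  set U := univ.filter (fun Y : Fin d → Bool => des (ivBig Y g) S 0 = none) with hU
  have hsub : U ⊆
      univ.filter (fun Y : Fin d → Bool => ∀ t ∈ tests, |bsum Y t.1| < t.2) := by
    intro Y hY
    rw [hU, Finset.mem_filter] at hY
    rw [Finset.mem_filter]
    refine ⟨hY.1, fun t ht => ?_⟩
    rw [htests, List.mem_map] at ht
    obtain ⟨R, hR, rfl⟩ := ht
    exact ring_small_of_des_none S hS Y hY.2 R hR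
  -- at least `q = ⌊d/64g²⌋` tests
  have hq : d / (64 * g ^ 2) ≤ tests.length := by
    rw [htests, List.length_map]
    by_cases hd : 16 * g ^ 2 ≤ d
    · have h1 := length_rings _ hB S (by rw [hS]; exact hd)
      have h2 : 4 * (16 * g ^ 2) * (rings (16 * g ^ 2) S 0 none).length =
          64 * g ^ 2 * (rings (16 * g ^ 2) S 0 none).length := by ring
      rw [hS, h2] at h1
      exact Nat.div_le_of_le_mul (by omega)
    · rw [Nat.div_eq_of_lt (by omega)]
      exact Nat.zero_le _
  -- cancel `16^(r−q) ≥ 13^(r−q)`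
  obtain ⟨e, he⟩ := Nat.exists_eq_add_of_le hq
  rw [he, pow_add, pow_add] at hprod
  have hcard := Finset.card_le_card hsub
  have h13 : 13 ^ e ≤ 16 ^ e := Nat.pow_le_pow_left (by norm_num) e
  refine Nat.le_of_mul_le_mul_right ?_ (pow_pos (by norm_num : 0 < 16) e)
  calc 16 ^ (d / (64 * g ^ 2)) * U.card * 16 ^ e
        = 16 ^ (d / (64 * g ^ 2)) * 16 ^ e * U.card := by ring
    _ ≤ 16 ^ (d / (64 * g ^ 2)) * 16 ^ e *
          (univ.filter (fun Y : Fin d → Bool => ∀ t ∈ tests, |bsum Y t.1| < t.2)).card :=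
        Nat.mul_le_mul_left _ hcard
    _ ≤ 13 ^ (d / (64 * g ^ 2)) * 13 ^ e * 2 ^ d := hprod
    _ ≤ 13 ^ (d / (64 * g ^ 2)) * 16 ^ e * 2 ^ d :=
        Nat.mul_le_mul_right _ (Nat.mul_le_mul_left _ h13)
    _ = 13 ^ (d / (64 * g ^ 2)) * 2 ^ d * 16 ^ e := by ring

/-! ### §4 Balanced masks and the union bound -/

/-- balanced masks are many: `4^n ≤ (2n+1)·#{Y : |Y| = n}`
(`Nat.four_pow_le_two_mul_add_one_mul_central_binom` BY NAME).
[cite: LagardeLimayeSrinivasan2018, Theorem 13] -/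
theorem four_pow_le_card_balanced (n : ℕ) :
    4 ^ n ≤ (2 * n + 1) *
      (univ.filter (fun Y : Fin (2 * n) → Bool =>
        Fintype.card {i : Fin (2 * n) // Y i = true} = n)).card := by
  have key : (univ.filter (fun Y : Fin (2 * n) → Bool =>
      Fintype.card {i : Fin (2 * n) // Y i = true} = n)).card =
      ((univ : Finset (Fin (2 * n))).powersetCard n).card := by
    refine Finset.card_nbij' (fun Y => univ.filter (fun i => Y i = true))
      (fun A => fun i => decide (i ∈ A)) (fun Y hY => ?_) (fun A hA => ?_) (fun Y _ => ?_)
      (fun A _ => ?_)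
    · rw [Finset.mem_coe, Finset.mem_filter, Fintype.card_subtype] at hY
      rw [Finset.mem_coe, Finset.mem_powersetCard]
      exact ⟨Finset.subset_univ _, hY.2⟩
    · rw [Finset.mem_coe, Finset.mem_powersetCard] at hA
      rw [Finset.mem_coe, Finset.mem_filter, Fintype.card_subtype]
      refine ⟨Finset.mem_univ _, (congrArg Finset.card ?_).trans hA.2⟩
      ext i
      simp
    · funext i
      simp
    · ext i
      simp
  rw [key, Finset.card_powersetCard, Finset.card_univ, Fintype.card_fin]
  exact Nat.four_pow_le_two_mul_add_one_mul_central_binom n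

/-- ★ UNION BOUND: a short list of shapes of size `2n` is simultaneously designated (at imbalance
`g`) by some balanced mask. [cite: FijalkowLagardeOhlmannSerre2020, Theorem 23]
[cite: LagardeLimayeSrinivasan2018, Theorem 13] -/
theorem exists_balanced_designating {n g : ℕ} (hg : 1 ≤ g) (L : List Shape)
    (hsz : ∀ S ∈ L, S.size = 2 * n)
    (hL : L.length * (2 * n + 1) * 13 ^ (2 * n / (64 * g ^ 2)) < 16 ^ (2 * n / (64 * g ^ 2))) :
    ∃ Y : Fin (2 * n) → Bool, Fintype.card {i : Fin (2 * n) // Y i = true} = n ∧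
      ∀ S ∈ L, des (ivBig Y g) S 0 ≠ none := by
  classical
  by_contra hcon
  push Not at hcon
  set q := 2 * n / (64 * g ^ 2) with hq
  set Bal := univ.filter (fun Y : Fin (2 * n) → Bool =>
    Fintype.card {i : Fin (2 * n) // Y i = true} = n) with hBal
  set U := fun S : Shape => univ.filter (fun Y : Fin (2 * n) → Bool => des (ivBig Y g) S 0 = none)
    with hU
  have hcover : Bal ⊆ L.toFinset.biUnion U := by
    intro Y hY
    rw [hBal, Finset.mem_filter] at hY
    obtain ⟨S, hS, hd⟩ := hcon Y hY.2
    rw [Finset.mem_biUnion]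
    exact ⟨S, List.mem_toFinset.2 hS, Finset.mem_filter.2 ⟨Finset.mem_univ _, hd⟩⟩
  have h1 : 16 ^ q * Bal.card ≤ L.length * (13 ^ q * 4 ^ n) := by
    have h4 : (2 : ℕ) ^ (2 * n) = 4 ^ n := by rw [pow_mul]; norm_num
    calc 16 ^ q * Bal.card ≤ 16 ^ q * (L.toFinset.biUnion U).card :=
          Nat.mul_le_mul_left _ (Finset.card_le_card hcover)
      _ ≤ 16 ^ q * ∑ S ∈ L.toFinset, (U S).card :=
          Nat.mul_le_mul_left _ Finset.card_biUnion_le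
      _ = ∑ S ∈ L.toFinset, 16 ^ q * (U S).card := Finset.mul_sum _ _ _
      _ ≤ ∑ S ∈ L.toFinset, 13 ^ q * 4 ^ n := Finset.sum_le_sum fun S hS => by
          rw [← h4]; exact card_undesignated_le g hg S (hsz S (List.mem_toFinset.1 hS))
      _ = L.toFinset.card * (13 ^ q * 4 ^ n) := by rw [Finset.sum_const, smul_eq_mul]
      _ ≤ L.length * (13 ^ q * 4 ^ n) := Nat.mul_le_mul_right _ (List.toFinset_card_le L)
  have h2 := four_pow_le_card_balanced n
  have h5 : 16 ^ q * 4 ^ n ≤ (L.length * (2 * n + 1) * 13 ^ q) * 4 ^ n :=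
    calc 16 ^ q * 4 ^ n ≤ 16 ^ q * ((2 * n + 1) * Bal.card) := Nat.mul_le_mul_left _ h2
      _ = (2 * n + 1) * (16 ^ q * Bal.card) := by ring
      _ ≤ (2 * n + 1) * (L.length * (13 ^ q * 4 ^ n)) := Nat.mul_le_mul_left _ h1
      _ = (L.length * (2 * n + 1) * 13 ^ q) * 4 ^ n := by ring
  have h6 : (L.length * (2 * n + 1) * 13 ^ q) * 4 ^ n < 16 ^ q * 4 ^ n :=
    Nat.mul_lt_mul_of_pos_right hL (pow_pos (by norm_num) n)
  exact absurd (h5.trans_lt h6) (lt_irrefl _)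

end Summit.ValiantsHypothesis.ValiantsHypothesis.Theorems.NcShapeAnticoncentration
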